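import Mathlib

/-!
# `GrenetZeon.DualUnipotentThreeHalves` (stmt-ValiantsHypothesis-24318) — line «radical_split», R2 DOSSIER bricks:
# (D2) trace isotropy of a nilpotent pencil, (D3) core rigidity of a nilpotent space with a power-fat upper core

Port (val-lit merged desk g12, b71 (B) port pool RULING #142; porter val-port-1 g2; text = val-idea-9 g3's, credited)
of §6 «R2 DOSSIER bricks» of the crux workfile `Cruxes/DualUnipotentThreeHalves/Lines/radical_split.lean`
@c1d3cc342f4d (val-idea-9 g3, 2026-08-28 11:02Z; kernel-checked there, sorry-free).  Crux workfiles are not importable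
from `Theorems/`, so the bricks are re-landed here VERBATIM (same names, same signatures, same proofs) for a future
seat on the line's one open law R2 `HeavyTopLaw` to import by name.

* `pow_sub_pow_telescope` — `X^(k+1) - Y^(k+1) = ∑_{i ≤ k} X^i (X - Y) Y^(k-i)` in any ring.
* `trace_pow_mul_eq_zero_of_pencil` — **(D2)**: if `A + t • B` is nilpotent for every `t : ℂ`, then
  `tr (A^k * B) = 0` for every `k` (Mathes–Omladič–Radjavi 1991, Lemmas 1–2, char 0; here over `ℂ`, by the
  telescoping identity `t · g(t) = tr((A+tB)^(k+1)) - tr(A^(k+1)) = 0` and continuity of `g` at `t = 0`).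
* `trace_mul_eq_zero_of_mem_span_powers` — (D2) extended linearly to the span of powers of members of a nilpotent
  space `L`, against any `B ∈ L`.
* `pow_apply_of_upper` — powers of a weakly upper-triangular matrix are weakly upper triangular with diagonal
  `(B^k) a a = (B a a)^k`.
* `core_rigidity` — **(D3)**: a linear space `L` of nilpotent matrices whose STRICTLY upper-triangular members'
  powers span every elementary matrix `E a b`, `a < b` (a «power-fat core») lies in `𝔫_m`: every member of `L`
  is strictly upper triangular (so `L` is triangularisable and carries no twist; any counterexample to R2 has a
  power-thin core).

Honest framing.  Helper lemmas only (`--supports stmt-ValiantsHypothesis-24318 --as helper`): they are NOT stubs and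
NOT on the proof path of any registered item — R2 groundwork only (val-lit desk g12 RULING #284); R2 `HeavyTopLaw`, the crux `DualUnipotentThreeHalves`, rung 8062 and
`VP ≠ VNP` are untouched / NOT proved.  No definitions, no named facts; Mathlib only.  [folklore] linear algebra;
(D2) [cite: Mathes–Omladič–Radjavi, Linear spaces of nilpotent matrices, Linear Algebra Appl. 149 (1991), Lemmas 1–2].
-/

-- `Summit.ValiantsHypothesis.ValiantsHypothesis.…` repeats a component by the D-0017 layout
-- (single-conjunct summit), which the `dupNamespace` linter flags; the name is mandated.
set_option linter.dupNamespace false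

namespace Summit.ValiantsHypothesis.ValiantsHypothesis.Theorems.GrenetZeon.RadicalSplit

open Matrix
open scoped BigOperators

variable {m : ℕ}

/-- Telescoping in a (noncommutative) ring: `X^(k+1) - Y^(k+1) = ∑_{i ≤ k} X^i (X - Y) Y^(k-i)`. -/
theorem pow_sub_pow_telescope {R : Type*} [Ring R] (X Y : R) (k : ℕ) :
    X ^ (k + 1) - Y ^ (k + 1) = ∑ i ∈ Finset.range (k + 1), X ^ i * (X - Y) * Y ^ (k - i) := by
  induction k with
  | zero => simp
  | succ k ih =>
    rw [Finset.sum_range_succ, Nat.sub_self, pow_zero, mul_one]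
    have h : ∑ i ∈ Finset.range (k + 1), X ^ i * (X - Y) * Y ^ (k + 1 - i)
        = (∑ i ∈ Finset.range (k + 1), X ^ i * (X - Y) * Y ^ (k - i)) * Y := by
      rw [Finset.sum_mul]
      refine Finset.sum_congr rfl fun i hi => ?_
      have hi' : i ≤ k := Nat.lt_succ_iff.mp (Finset.mem_range.mp hi)
      rw [show k + 1 - i = (k - i) + 1 by omega, pow_succ]
      simp only [mul_assoc]
    rw [h, ← ih]
    noncomm_ring

/-- **(D2) Trace isotropy of a nilpotent pencil (char 0).** If `A + t • B` is nilpotent for every `t : ℂ`,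
then `tr (A^k * B) = 0` for every `k`. -/
theorem trace_pow_mul_eq_zero_of_pencil (A B : Matrix (Fin m) (Fin m) ℂ)
    (h : ∀ t : ℂ, IsNilpotent (A + t • B)) (k : ℕ) : Matrix.trace (A ^ k * B) = 0 := by
  -- g t := ∑_{i ≤ k} tr ((A + tB)^i * B * A^(k-i)); for t ≠ 0, t * g t = tr((A+tB)^(k+1)) - tr(A^(k+1)) = 0.
  set g : ℂ → ℂ := fun t => ∑ i ∈ Finset.range (k + 1), Matrix.trace ((A + t • B) ^ i * B * A ^ (k - i)) with hg
  have hA : IsNilpotent A := by simpa using h 0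
  have key : ∀ t : ℂ, t * g t = 0 := by
    intro t
    have h1 : Matrix.trace ((A + t • B) ^ (k + 1)) = 0 :=
      Matrix.isNilpotent_trace_of_isNilpotent ((h t).pow_succ k) |>.eq_zero
    have h2 : Matrix.trace (A ^ (k + 1)) = 0 :=
      Matrix.isNilpotent_trace_of_isNilpotent (hA.pow_succ k) |>.eq_zero
    have h3 := congrArg Matrix.trace (pow_sub_pow_telescope (A + t • B) A k)
    rw [Matrix.trace_sub, h1, h2, sub_zero, Matrix.trace_sum] at h3
    rw [hg]; simp only
    rw [Finset.mul_sum]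
    refine (Eq.trans (Finset.sum_congr rfl fun i _ => ?_) h3.symm)
    rw [add_sub_cancel_left, Matrix.mul_smul, Matrix.smul_mul, Matrix.trace_smul, smul_eq_mul]
  have hcont : Continuous g := by
    rw [hg]
    refine continuous_finsetSum _ fun i _ => ?_
    have hf : Continuous fun t : ℂ => A + t • B := continuous_const.add (continuous_id.smul continuous_const)
    exact (((hf.pow i).mul continuous_const).mul continuous_const).matrix_trace
  have hzero : ∀ t : ℂ, t ≠ 0 → g t = 0 := fun t ht => by
    have := key t
    rcases mul_eq_zero.mp this with h0 | h0
    · exact absurd h0 ht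
    · exact h0
  have hg0 : g 0 = 0 := by
    -- density of `{t ≠ 0}` and continuity
    have hdense : Dense ({0}ᶜ : Set ℂ) := dense_compl_singleton 0
    have heq : Set.EqOn g 0 ({0}ᶜ : Set ℂ) := fun t ht => hzero t (Set.mem_compl_singleton_iff.mp ht)
    have hfun := Continuous.ext_on hdense hcont continuous_zero heq
    exact congrFun hfun 0
  -- g 0 = (k+1) • tr (A^k * B)
  have hg0' : g 0 = ∑ i ∈ Finset.range (k + 1), Matrix.trace (A ^ k * B) := by
    rw [hg]; simp only [zero_smul, add_zero]
    refine Finset.sum_congr rfl fun i hi => ?_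
    have hi' : i ≤ k := Nat.lt_succ_iff.mp (Finset.mem_range.mp hi)
    rw [Matrix.trace_mul_cycle, ← pow_add, show k - i + i = k by omega]
  rw [hg0', Finset.sum_const, Finset.card_range, nsmul_eq_mul] at hg0
  have hk : ((k + 1 : ℕ) : ℂ) ≠ 0 := by exact_mod_cast Nat.succ_ne_zero k
  exact (mul_eq_zero.mp hg0).resolve_left hk

/-- Trace orthogonality extends linearly from powers of members of `L` to their span. -/
theorem trace_mul_eq_zero_of_mem_span_powers (L : Submodule ℂ (Matrix (Fin m) (Fin m) ℂ))
    (hL : ∀ A ∈ L, IsNilpotent A) (S : Set (Matrix (Fin m) (Fin m) ℂ))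
    (hS : ∀ X ∈ S, ∃ u ∈ L, ∃ k : ℕ, X = u ^ k)
    {X : Matrix (Fin m) (Fin m) ℂ} (hX : X ∈ Submodule.span ℂ S)
    {B : Matrix (Fin m) (Fin m) ℂ} (hB : B ∈ L) : Matrix.trace (X * B) = 0 := by
  induction hX using Submodule.span_induction with
  | mem X hXS =>
    obtain ⟨u, hu, k, rfl⟩ := hS X hXS
    refine trace_pow_mul_eq_zero_of_pencil u B (fun t => hL _ ?_) k
    exact L.add_mem hu (L.smul_mem t hB)
  | zero => simp
  | add X Y _ _ hX hY => rw [Matrix.add_mul, Matrix.trace_add, hX, hY, add_zero]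
  | smul c X _ hX => rw [Matrix.smul_mul, Matrix.trace_smul, hX, smul_zero]

/-- Diagonal entries of powers of a (weakly) upper-triangular matrix. -/
theorem pow_apply_of_upper (B : Matrix (Fin m) (Fin m) ℂ) (hB : ∀ a b : Fin m, b < a → B a b = 0) (k : ℕ) :
    (∀ a b : Fin m, b < a → (B ^ k) a b = 0) ∧ ∀ a : Fin m, (B ^ k) a a = B a a ^ k := by
  induction k with
  | zero =>
    refine ⟨fun a b hab => ?_, fun a => ?_⟩
    · rw [pow_zero, Matrix.one_apply_ne (ne_of_gt hab)]
    · rw [pow_zero, pow_zero, Matrix.one_apply_eq]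
  | succ k ih =>
    obtain ⟨ih1, ih2⟩ := ih
    refine ⟨fun a b hab => ?_, fun a => ?_⟩
    · rw [pow_succ, Matrix.mul_apply]
      refine Finset.sum_eq_zero fun c _ => ?_
      by_cases hca : c < a
      · rw [ih1 a c hca, zero_mul]
      · have hbc : b < c := lt_of_lt_of_le hab (not_lt.mp hca)
        rw [hB c b hbc, mul_zero]
    · rw [pow_succ, Matrix.mul_apply, Finset.sum_eq_single a, ih2 a, pow_succ]
      · intro c _ hca
        rcases lt_or_gt_of_ne hca with h | h
        · rw [ih1 a c h, zero_mul]
        · rw [hB c a h, mul_zero]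
      · intro h; exact absurd (Finset.mem_univ a) h

/-- **(D3) Core rigidity.** Let `L` be a linear space of nilpotent matrices. If the span of the powers of the
STRICTLY UPPER-TRIANGULAR members of `L` contains every elementary matrix `E a b` with `a < b` (a «power-fat core»),
then every member of `L` is strictly upper triangular — so `L` is triangularisable and carries no twist. -/
theorem core_rigidity (L : Submodule ℂ (Matrix (Fin m) (Fin m) ℂ)) (hL : ∀ A ∈ L, IsNilpotent A)
    (hspan : ∀ a b : Fin m, a < b → Matrix.single a b (1 : ℂ) ∈
      Submodule.span ℂ {X | ∃ u ∈ L, ∃ k : ℕ, (∀ a b : Fin m, b ≤ a → u a b = 0) ∧ X = u ^ k})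
    (B : Matrix (Fin m) (Fin m) ℂ) (hB : B ∈ L) : ∀ a b : Fin m, b ≤ a → B a b = 0 := by
  -- strictly lower entries vanish by trace orthogonality against the elementary matrices
  have hlow : ∀ a b : Fin m, b < a → B a b = 0 := by
    intro a b hba
    have h := trace_mul_eq_zero_of_mem_span_powers L hL _ (fun X hX => ?_) (hspan b a hba) hB
    · rwa [Matrix.trace_single_mul, one_smul] at h
    · obtain ⟨u, hu, k, -, rfl⟩ := hX
      exact ⟨u, hu, k, rfl⟩
  intro a b hba
  rcases lt_or_eq_of_le hba with h | h
  · exact hlow a b h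
  · subst h
    -- diagonal entries: `B` is upper triangular and nilpotent
    obtain ⟨N, hN⟩ := hL B hB
    have hN1 : B ^ (N + 1) = 0 := by rw [pow_succ, hN, zero_mul]
    have hdiag := (pow_apply_of_upper B hlow (N + 1)).2 b
    rw [hN1, Matrix.zero_apply] at hdiag
    exact pow_eq_zero_iff (Nat.succ_ne_zero N) |>.mp hdiag.symm


end Summit.ValiantsHypothesis.ValiantsHypothesis.Theorems.GrenetZeon.RadicalSplit
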